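import Mathlib
import Summits.MatrixMultiplication.MatrixMultiplication.Theses.FidelityWitnesses
import Summits.MatrixMultiplication.MatrixMultiplication.Theorems.FidelityWitnessesFidelityGapTwoSix

/-!
# `FidelityWitnesses.SixEighthsAtFive` (stmt-MatrixMultiplication-14040) — the two-witness reduction

A second, independent reduction of the support item `SixEighthsAtFive` (`M(2,5) ≤ 6`:
`‖Σ S·⟨2,2,2⟩‖² ≤ 6 · Σ‖S‖²` for `rank S ≤ 5`), complementary to the hard-regime frame reduction of
`FidelityWitnessesSixEighthsAtFive.lean`.

WITNESS LEMMA (`sixEighthsAtFive_witness`, pure Hilbert-space geometry in `ℂ^{P2×P2×P2}`, `P2 = Fin 2 × Fin 2`,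
`⟨f,g⟩ = Σ conj f · g`).  If the orthogonal complement of `S` contains two orthonormal tensors `t₁, t₂` whose
overlaps with `T = ⟨2,2,2⟩` are unimodular, `|⟨tᵢ,T⟩| = 1`, then `|Σ S·T|² ≤ 6 · Σ|S|²`:
project `T` onto the line `ℂ S` (`λ = ⟨S,T⟩/Σ|S|²`), so `Σ|T − λS|² = 8 − |Σ S·T|²/Σ|S|²`, while Bessel for
`t₁, t₂ ⟂ S` gives `Σ|T − λS|² ≥ |⟨t₁,T⟩|² + |⟨t₂,T⟩|² = 2`.

WHY THIS IS THE RIGHT INTERFACE.  The unit tensors with unimodular `T`-overlap are exactly the `U(2)³`-rotated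
unit products `t(p,q,s) : (a,b,c) ↦ conj(p a.1) s a.2 · p b.1 conj(q b.2) · q c.1 conj(s c.2)` (`p,q,s` unit
vectors of `ℂ²`; equality case of Cauchy–Schwarz along the multiplication chain), two of them being orthogonal
iff `p ⟂ p'` or `q ⟂ q'` or `s ⟂ s'`.  At every known maximiser of the `(2,5)` fidelity problem the residual
`T − P_{ℂS}T` IS such a pair: Bini's limit (`⟨2,2,2⟩` minus the two `a₂₂`-products: `t(e₂,e₂,e₁), t(e₂,e₂,e₂)`) and
the antipodal limit (`⟨2,2,2⟩` minus `a₁₁b₁₁c₁₁` and `a₂₂b₂₂c₂₂`: `t(e₁,e₁,e₁), t(e₂,e₂,e₂)`; a second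
border-rank-5 deletion, found numerically), so the lemma is sharp exactly where the item is.
Conjecture (W2), numerically verified on random, structured and near-optimal rank-5 tensors (exact zeros found to
`1e-17`; it fails, as it must, for `T` (rank 7) and for `T` minus one product (rank 6, fidelity `7`)): EVERY tensor
of rank `≤ 5` in the `2×2` format is annihilated by two orthogonal rotated unit products.
`sixEighthsAtFive_of_witnesses` records (W2), in its weakest useful form, as a sufficient condition for the item.
-/

set_option linter.dupNamespace false

namespace Summit.MatrixMultiplication.MatrixMultiplication.Theorems

open scoped BigOperators ComplexConjugate InnerProductSpace
open Literature.Computability.AlgebraicComplexity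

-- The Euclidean space on the triple index type (notation only, no new constant).
local notation "𝓥₃" => EuclideanSpace ℂ ((Fin 2 × Fin 2) × (Fin 2 × Fin 2) × (Fin 2 × Fin 2))

-- Transport of a `3`-slot tensor on `P2 = Fin 2 × Fin 2` to `𝓥₃`, so that `⟪·,·⟫` and `‖·‖` are the coordinate
-- Hermitian product and the Frobenius norm (notation only, no new constant).
local notation "𝓿[" f "]" =>
  (WithLp.toLp 2 (fun abc : (Fin 2 × Fin 2) × (Fin 2 × Fin 2) × (Fin 2 × Fin 2) =>
    f (Prod.fst abc) (Prod.fst (Prod.snd abc)) (Prod.snd (Prod.snd abc))) : 𝓥₃)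

/-- The Euclidean inner product of transported tensors is `Σ conj f · g`. [folklore] -/
theorem sixEighthsAtFive_inner_vec3 (f g : (Fin 2 × Fin 2) → (Fin 2 × Fin 2) → (Fin 2 × Fin 2) → ℂ) :
    ⟪𝓿[f], 𝓿[g]⟫_ℂ = ∑ a, ∑ b, ∑ c, conj (f a b c) * g a b c := by
  simp only [PiLp.inner_apply, RCLike.inner_apply', Fintype.sum_prod_type]

/-- The Euclidean norm of a transported tensor is the Frobenius norm. [folklore] -/
theorem sixEighthsAtFive_norm_sq_vec3 (f : (Fin 2 × Fin 2) → (Fin 2 × Fin 2) → (Fin 2 × Fin 2) → ℂ) :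
    ‖𝓿[f]‖ ^ 2 = ∑ a, ∑ b, ∑ c, ‖f a b c‖ ^ 2 := by
  rw [EuclideanSpace.norm_sq_eq]
  simp only [Fintype.sum_prod_type]

/-- `Σ conj f · f = Σ |f|²` as a complex number. [folklore] -/
theorem sixEighthsAtFive_sum_conj_mul_self (f : (Fin 2 × Fin 2) → (Fin 2 × Fin 2) → (Fin 2 × Fin 2) → ℂ) :
    (∑ a, ∑ b, ∑ c, conj (f a b c) * f a b c) = ((∑ a, ∑ b, ∑ c, ‖f a b c‖ ^ 2 : ℝ) : ℂ) := by
  push_cast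
  exact Finset.sum_congr rfl fun a _ => Finset.sum_congr rfl fun b _ =>
    Finset.sum_congr rfl fun c _ => by rw [Complex.conj_mul']

/-- **Witness lemma.** If two orthonormal tensors `t₁, t₂` (for `⟨f,g⟩ = Σ conj f · g` on `ℂ^{P2×P2×P2}`) are
orthogonal to `S` and have unimodular overlap with `⟨2,2,2⟩`, then `|Σ S·⟨2,2,2⟩|² ≤ 6 · Σ|S|²`
(`‖P_{S^⟂} T‖² ≥ 2` by Bessel, and `‖P_{S^⟂}T‖² = 8 − |Σ S·T|²/Σ|S|²`). [folklore] -/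
theorem sixEighthsAtFive_witness
    (S t₁ t₂ : (Fin 2 × Fin 2) → (Fin 2 × Fin 2) → (Fin 2 × Fin 2) → ℂ)
    (h1 : (∑ a, ∑ b, ∑ c, ‖t₁ a b c‖ ^ 2) = 1) (h2 : (∑ a, ∑ b, ∑ c, ‖t₂ a b c‖ ^ 2) = 1)
    (h12 : (∑ a, ∑ b, ∑ c, conj (t₁ a b c) * t₂ a b c) = 0)
    (hS1 : (∑ a, ∑ b, ∑ c, conj (t₁ a b c) * S a b c) = 0)
    (hS2 : (∑ a, ∑ b, ∑ c, conj (t₂ a b c) * S a b c) = 0)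
    (hT1 : ‖∑ a, ∑ b, ∑ c, conj (t₁ a b c) * matMulTensor ℂ 2 2 2 a b c‖ = 1)
    (hT2 : ‖∑ a, ∑ b, ∑ c, conj (t₂ a b c) * matMulTensor ℂ 2 2 2 a b c‖ = 1) :
    ‖∑ a, ∑ b, ∑ c, S a b c * matMulTensor ℂ 2 2 2 a b c‖ ^ 2 ≤
      6 * ∑ a, ∑ b, ∑ c, ‖S a b c‖ ^ 2 := by
  classical
  -- names
  set N : ℝ := ∑ a, ∑ b, ∑ c, ‖S a b c‖ ^ 2 with hN
  set ov : ℂ := ∑ a, ∑ b, ∑ c, S a b c * matMulTensor ℂ 2 2 2 a b c with hov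
  set T3 := 𝓿[matMulTensor ℂ 2 2 2] with hT3
  set S3 := 𝓿[S] with hS3
  have hT8 : ‖T3‖ ^ 2 = 8 := by
    rw [hT3, sixEighthsAtFive_norm_sq_vec3, fidelityGapTwoSix_normSq_matMulTensor_two]
  have hSS : ‖S3‖ ^ 2 = N := by rw [hS3, sixEighthsAtFive_norm_sq_vec3]
  -- `⟪S3, T3⟫ = conj ov` (`T` is real)
  have hST : ⟪S3, T3⟫_ℂ = conj ov := by
    rw [hS3, hT3, sixEighthsAtFive_inner_vec3, hov]
    simp only [map_sum, map_mul, fidelityGapTwoSix_conj_matMulTensor_two]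
  have hTS : ⟪T3, S3⟫_ℂ = ov := by
    rw [← inner_conj_symm, hST]; simp
  -- orthonormal pair
  let e : Fin 2 → 𝓥₃ := ![𝓿[t₁], 𝓿[t₂]]
  have h21 : (∑ a, ∑ b, ∑ c, conj (t₂ a b c) * t₁ a b c) = 0 := by
    have : (∑ a, ∑ b, ∑ c, conj (t₂ a b c) * t₁ a b c) =
        conj (∑ a, ∑ b, ∑ c, conj (t₁ a b c) * t₂ a b c) := by
      simp only [map_sum, map_mul, Complex.conj_conj]
      exact Finset.sum_congr rfl fun a _ => Finset.sum_congr rfl fun b _ =>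
        Finset.sum_congr rfl fun c _ => mul_comm _ _
    rw [this, h12, map_zero]
  have he : Orthonormal ℂ e := by
    rw [orthonormal_iff_ite]
    intro i j
    fin_cases i <;> fin_cases j
    · show ⟪𝓿[t₁], 𝓿[t₁]⟫_ℂ = 1
      rw [sixEighthsAtFive_inner_vec3, sixEighthsAtFive_sum_conj_mul_self, h1]; simp
    · show ⟪𝓿[t₁], 𝓿[t₂]⟫_ℂ = 0
      rw [sixEighthsAtFive_inner_vec3, h12]
    · show ⟪𝓿[t₂], 𝓿[t₁]⟫_ℂ = 0
      rw [sixEighthsAtFive_inner_vec3, h21]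
    · show ⟪𝓿[t₂], 𝓿[t₂]⟫_ℂ = 1
      rw [sixEighthsAtFive_inner_vec3, sixEighthsAtFive_sum_conj_mul_self, h2]; simp
  -- degenerate case `S = 0`
  have hN0 : 0 ≤ N := by positivity
  rcases hN0.lt_or_eq with hNpos | hN00
  swap
  · have hS0 : S3 = 0 := by
      have : ‖S3‖ = 0 := by
        have h := hSS; rw [← hN00] at h
        exact pow_eq_zero_iff (n := 2) (by norm_num) |>.1 h
      exact norm_eq_zero.1 this
    have hov0 : ov = 0 := by rw [← hTS, hS0, inner_zero_right]
    rw [hov0, ← hN00]; simp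
  -- the residual `D = T − λ S`, `λ = conj ov / N`
  set lam : ℂ := conj ov / (N : ℂ) with hlam
  set D := T3 - lam • S3 with hDdef
  -- Bessel
  have hB := he.sum_inner_products_le D (s := Finset.univ)
  have hD : ∀ (t : (Fin 2 × Fin 2) → (Fin 2 × Fin 2) → (Fin 2 × Fin 2) → ℂ),
      (∑ a, ∑ b, ∑ c, conj (t a b c) * S a b c) = 0 →
      ⟪𝓿[t], D⟫_ℂ = ∑ a, ∑ b, ∑ c, conj (t a b c) * matMulTensor ℂ 2 2 2 a b c := by
    intro t ht
    rw [hDdef, hT3, hS3, inner_sub_right, inner_smul_right, sixEighthsAtFive_inner_vec3,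
      sixEighthsAtFive_inner_vec3, ht, mul_zero, sub_zero]
  have hBessel : (2 : ℝ) ≤ ‖D‖ ^ 2 := by
    have hsum : ∑ i : Fin 2, ‖⟪e i, D⟫_ℂ‖ ^ 2 = 2 := by
      rw [Fin.sum_univ_two]
      show ‖⟪𝓿[t₁], D⟫_ℂ‖ ^ 2 + ‖⟪𝓿[t₂], D⟫_ℂ‖ ^ 2 = 2
      rw [hD t₁ hS1, hD t₂ hS2, hT1, hT2]; norm_num
    linarith [hB]
  -- ‖D‖² = 8 − |ov|²/N
  have hDnorm : ‖D‖ ^ 2 = 8 - ‖ov‖ ^ 2 / N := by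
    rw [hDdef, @norm_sub_sq ℂ, hT8, inner_smul_right, norm_smul, mul_pow, hSS, hTS, hlam]
    have hre : RCLike.re (conj ov / (N : ℂ) * ov) = ‖ov‖ ^ 2 / N := by
      have : conj ov / (N : ℂ) * ov = ((‖ov‖ ^ 2 / N : ℝ) : ℂ) := by
        rw [div_mul_eq_mul_div, Complex.conj_mul' ov]
        push_cast; ring
      rw [this]; exact RCLike.ofReal_re _
    rw [hre]
    have hlamn : ‖conj ov / (N : ℂ)‖ ^ 2 = ‖ov‖ ^ 2 / N ^ 2 := by
      rw [norm_div, Complex.norm_conj, Complex.norm_real, Real.norm_of_nonneg hN0, div_pow]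
    rw [hlamn]
    field_simp
    ring
  -- conclude
  rw [hDnorm] at hBessel
  have key : ‖ov‖ ^ 2 / N ≤ 6 := by linarith
  rwa [div_le_iff₀ hNpos] at key

/-- **`SixEighthsAtFive` from the two-witness conjecture (W2), weakest useful form.**  If every tensor `S` of
rank `≤ 5` in the `2 × 2` format admits two orthonormal tensors in its orthogonal complement whose overlaps with
`⟨2,2,2⟩` are unimodular (conjecturally: two orthogonal `U(2)³`-rotated unit products
`t(p,q,s), t(p',q',s')` with `p ⟂ p' ∨ q ⟂ q' ∨ s ⟂ s'` annihilating `S` — the residual pair at both known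
extremal limits, Bini's and the antipodal one), then `M(2,5) ≤ 6`. [folklore] -/
theorem sixEighthsAtFive_of_witnesses
    (hW : ∀ S : (Fin 2 × Fin 2) → (Fin 2 × Fin 2) → (Fin 2 × Fin 2) → ℂ, tensorRank S ≤ 5 →
      ∃ t₁ t₂ : (Fin 2 × Fin 2) → (Fin 2 × Fin 2) → (Fin 2 × Fin 2) → ℂ,
        (∑ a, ∑ b, ∑ c, ‖t₁ a b c‖ ^ 2) = 1 ∧ (∑ a, ∑ b, ∑ c, ‖t₂ a b c‖ ^ 2) = 1 ∧
        (∑ a, ∑ b, ∑ c, conj (t₁ a b c) * t₂ a b c) = 0 ∧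
        (∑ a, ∑ b, ∑ c, conj (t₁ a b c) * S a b c) = 0 ∧
        (∑ a, ∑ b, ∑ c, conj (t₂ a b c) * S a b c) = 0 ∧
        ‖∑ a, ∑ b, ∑ c, conj (t₁ a b c) * matMulTensor ℂ 2 2 2 a b c‖ = 1 ∧
        ‖∑ a, ∑ b, ∑ c, conj (t₂ a b c) * matMulTensor ℂ 2 2 2 a b c‖ = 1) :
    Summit.MatrixMultiplication.MatrixMultiplication.Theses.FidelityWitnesses.SixEighthsAtFive := by
  intro S hS
  obtain ⟨t₁, t₂, h1, h2, h12, hS1, hS2, hT1, hT2⟩ := hW S hS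
  exact sixEighthsAtFive_witness S t₁ t₂ h1 h2 h12 hS1 hS2 hT1 hT2

/-- **Witness lemma, family form.** For ANY finite orthonormal family `t : Fin m → …` of tensors orthogonal to
`S` (for `⟨f,g⟩ = Σ conj f · g` on `ℂ^{P2×P2×P2}`), `|Σ S·⟨2,2,2⟩|² ≤ (8 − Σ_i |⟨t_i,⟨2,2,2⟩⟩|²) · Σ|S|²`
(`‖P_{S^⟂}T‖² ≥ Σ_i |⟨t_i,T⟩|²` by Bessel and `‖P_{S^⟂}T‖² = 8 − |Σ S·T|²/Σ|S|²`).  This is the interface for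
subspace witnesses, e.g. the term-killing product subspaces `Q_σ = 𝒲_σ^⟂ ⊗ 𝒳_σ^⟂ ⊗ 𝒴_σ^⟂ ⊂ S^⟂` of a 5-term
decomposition (assign each term to a slot whose factor the subspace avoids): `fid(S) ≤ 8 − ‖P_{Q_σ}T‖²`.
(Numerically, a single `Q_σ` captures `1.94–2.42` of `T` on random rank-5 tensors and `1.986–1.9996 < 2` on
near-optimal ones, pairs `Q_σ + Q_σ'` capture `≥ 2.004` everywhere tested; the exact two-product form (W2) above
has an apparent counterexample at fidelity `5.83`, so the family form is the one to use.) [folklore] -/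
theorem sixEighthsAtFive_witness_family {m : ℕ}
    (S : (Fin 2 × Fin 2) → (Fin 2 × Fin 2) → (Fin 2 × Fin 2) → ℂ)
    (t : Fin m → (Fin 2 × Fin 2) → (Fin 2 × Fin 2) → (Fin 2 × Fin 2) → ℂ)
    (hon : ∀ i j : Fin m, (∑ a, ∑ b, ∑ c, conj (t i a b c) * t j a b c) = if i = j then 1 else 0)
    (hS : ∀ i : Fin m, (∑ a, ∑ b, ∑ c, conj (t i a b c) * S a b c) = 0) :
    ‖∑ a, ∑ b, ∑ c, S a b c * matMulTensor ℂ 2 2 2 a b c‖ ^ 2 ≤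
      (8 - ∑ i, ‖∑ a, ∑ b, ∑ c, conj (t i a b c) * matMulTensor ℂ 2 2 2 a b c‖ ^ 2) *
        ∑ a, ∑ b, ∑ c, ‖S a b c‖ ^ 2 := by
  classical
  set N : ℝ := ∑ a, ∑ b, ∑ c, ‖S a b c‖ ^ 2 with hN
  set ov : ℂ := ∑ a, ∑ b, ∑ c, S a b c * matMulTensor ℂ 2 2 2 a b c with hov
  set cap : ℝ := ∑ i, ‖∑ a, ∑ b, ∑ c, conj (t i a b c) * matMulTensor ℂ 2 2 2 a b c‖ ^ 2 with hcap
  set T3 := 𝓿[matMulTensor ℂ 2 2 2] with hT3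
  set S3 := 𝓿[S] with hS3
  have hT8 : ‖T3‖ ^ 2 = 8 := by
    rw [hT3, sixEighthsAtFive_norm_sq_vec3, fidelityGapTwoSix_normSq_matMulTensor_two]
  have hSS : ‖S3‖ ^ 2 = N := by rw [hS3, sixEighthsAtFive_norm_sq_vec3]
  have hST : ⟪S3, T3⟫_ℂ = conj ov := by
    rw [hS3, hT3, sixEighthsAtFive_inner_vec3, hov]
    simp only [map_sum, map_mul, fidelityGapTwoSix_conj_matMulTensor_two]
  have hTS : ⟪T3, S3⟫_ℂ = ov := by
    rw [← inner_conj_symm, hST]; simp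
  -- the orthonormal family in the Euclidean picture
  let e : Fin m → 𝓥₃ := fun i => 𝓿[t i]
  have he : Orthonormal ℂ e := by
    rw [orthonormal_iff_ite]
    intro i j
    show ⟪𝓿[t i], 𝓿[t j]⟫_ℂ = _
    rw [sixEighthsAtFive_inner_vec3, hon i j]
  -- Bessel for the family against `T3` already bounds `cap ≤ 8`
  have hcap8 : cap ≤ 8 := by
    have hB0 := he.sum_inner_products_le T3 (s := Finset.univ)
    have : ∑ i, ‖⟪e i, T3⟫_ℂ‖ ^ 2 = cap := by
      rw [hcap]
      refine Finset.sum_congr rfl fun i _ => ?_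
      show ‖⟪𝓿[t i], 𝓿[matMulTensor ℂ 2 2 2]⟫_ℂ‖ ^ 2 = _
      rw [sixEighthsAtFive_inner_vec3]
    rw [this, hT8] at hB0
    exact hB0
  have hN0 : 0 ≤ N := by positivity
  rcases hN0.lt_or_eq with hNpos | hN00
  swap
  · have hS0 : S3 = 0 := by
      have : ‖S3‖ = 0 := by
        have h := hSS; rw [← hN00] at h
        exact pow_eq_zero_iff (n := 2) (by norm_num) |>.1 h
      exact norm_eq_zero.1 this
    have hov0 : ov = 0 := by rw [← hTS, hS0, inner_zero_right]
    rw [hov0, ← hN00]; simp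
  set lam : ℂ := conj ov / (N : ℂ) with hlam
  set D := T3 - lam • S3 with hDdef
  have hB := he.sum_inner_products_le D (s := Finset.univ)
  have hD : ∀ i : Fin m, ⟪e i, D⟫_ℂ = ∑ a, ∑ b, ∑ c, conj (t i a b c) * matMulTensor ℂ 2 2 2 a b c := by
    intro i
    show ⟪𝓿[t i], D⟫_ℂ = _
    rw [hDdef, hT3, hS3, inner_sub_right, inner_smul_right, sixEighthsAtFive_inner_vec3,
      sixEighthsAtFive_inner_vec3, hS i, mul_zero, sub_zero]
  have hBessel : cap ≤ ‖D‖ ^ 2 := by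
    have hsum : ∑ i, ‖⟪e i, D⟫_ℂ‖ ^ 2 = cap := by
      rw [hcap]; exact Finset.sum_congr rfl fun i _ => by rw [hD i]
    linarith [hB]
  have hDnorm : ‖D‖ ^ 2 = 8 - ‖ov‖ ^ 2 / N := by
    rw [hDdef, @norm_sub_sq ℂ, hT8, inner_smul_right, norm_smul, mul_pow, hSS, hTS, hlam]
    have hre : RCLike.re (conj ov / (N : ℂ) * ov) = ‖ov‖ ^ 2 / N := by
      have : conj ov / (N : ℂ) * ov = ((‖ov‖ ^ 2 / N : ℝ) : ℂ) := by
        rw [div_mul_eq_mul_div, Complex.conj_mul' ov]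
        push_cast; ring
      rw [this]; exact RCLike.ofReal_re _
    rw [hre]
    have hlamn : ‖conj ov / (N : ℂ)‖ ^ 2 = ‖ov‖ ^ 2 / N ^ 2 := by
      rw [norm_div, Complex.norm_conj, Complex.norm_real, Real.norm_of_nonneg hN0, div_pow]
    rw [hlamn]
    field_simp
    ring
  rw [hDnorm] at hBessel
  have key : ‖ov‖ ^ 2 / N ≤ 8 - cap := by linarith
  rw [div_le_iff₀ hNpos] at key
  linarith

end Summit.MatrixMultiplication.MatrixMultiplication.Theorems
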